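import Summits.NavierStokesRegularity.NavierStokesRegularity.Theorems.EfficiencyFloorRigidExitReferenceFlowH1Continuity
import Literature.Analysis.FluidPDE.NormalisedPressureDuality
import Summits.NavierStokesRegularity.NavierStokesRegularity.Theorems.EfficiencyFloorMaximiserSetRigidityOrbitAdmissible
import Summits.NavierStokesRegularity.NavierStokesRegularity.Theorems.EfficiencyFloorRigidExitResonanceOrbit
import HarnessLib

/-!
# Route `EfficiencyFloor`, support `RigidExit` (stmt-NavierStokesRegularity-25513) on the `ProductionEfficiencyDecay` ladder
# (stmt-NavierStokesRegularity-22866): THE SCALE OF A NEAR-MAXIMISER SLICE — first clause of the residue (R-shadow)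

Helper file (`--supports stmt-NavierStokesRegularity-22866`; line `efficiency_floor`). The residue (R-shadow) of
`ReferenceShadowing.rigidExit_of_referenceShadowing` (p839834) asks, for a slice `u(s)` that is `ε`-close (scale-free `Ḣ¹`) to an
orbit point `x ↦ l•R m(l•R⁻¹(x − a))` of a normalised maximiser `m`, for a scale `l > 0` with `l·Z(m) ≤ (1+κ)·Z(u s)` (and then the
flow comparison). This file settles the SCALE clause, with the orbit's own `l`:

* `sqrt_enstrophy_sub_le`, `enstrophy_window_of_close` — `L²` triangle inequality for vorticities: if `∫|curl(f − w)|² ≤ ε²∫|curl f|²`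
  (`0 ≤ ε`) for `C^∞` fields with `D⁰, D¹ ∈ L²`, then `(1 − ε)²·Z(f) ≤ Z(w) ≤ (1 + ε)²·Z(f)`;
* `orbit_scale_window` — for an admissible `m` and a slice `f` `ε`-close to the orbit point with parameters `(a, R, l)`:
  `(1 − ε)²·Z(f) ≤ l·Z(m) ≤ (1 + ε)²·Z(f)` (`Z(g·m) = l·Z(m)`, `Resonance.integral_curl_sq_orbitSlice`). In particular the first
  clause of (R-shadow) holds with `κ = 2ε + ε²`.

HONEST FRAMING: bookkeeping; (R-shadow)'s flow comparison, `RigidExit`, `NearMaximiserBoundedAmplification`, `LerayFloorGap`,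
`ProductionEfficiencyDecay` (stmt-22866) and Navier–Stokes regularity stay OPEN; no summit statement is proved. [folklore]
-/

-- the problem directory repeats the summit name (`NavierStokesRegularity/NavierStokesRegularity`)
set_option linter.dupNamespace false

noncomputable section

open Set Filter MeasureTheory Topology Function
open scoped InnerProductSpace RealInnerProductSpace ENNReal NNReal ContDiff
open Literature.Analysis.FluidPDE

namespace Summit.NavierStokesRegularity.NavierStokesRegularity.Theorems

namespace RigidExit

namespace ReferenceShadowing

open ReferenceFlow MaximiserSetRigidity.OrbitInvariance Resonance

section Scale

variable {f w : EuclideanSpace ℝ (Fin 3) → EuclideanSpace ℝ (Fin 3)}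

/-- `∫‖g‖² = ‖g‖²_{L²}` (real `L²` norm) for `g ∈ L²` (plumbing). [folklore] -/
theorem integral_norm_sq_eq_of_memLp {g : EuclideanSpace ℝ (Fin 3) → EuclideanSpace ℝ (Fin 3)} (hg : MemLp g 2 volume) :
    ∫ x, ‖g x‖ ^ 2 = ((eLpNorm g 2 volume).toReal) ^ 2 := by
  have hint : Integrable (fun x => ‖g x‖ ^ 2) := (memLp_two_iff_integrable_sq_norm hg.1).1 hg
  rw [integral_eq_lintegral_of_nonneg_ae (Eventually.of_forall fun x => by positivity) hint.aestronglyMeasurable]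
  have h : ∫⁻ x, ENNReal.ofReal (‖g x‖ ^ 2) = ∫⁻ x, ‖g x‖ₑ ^ 2 :=
    lintegral_congr fun x => by rw [ENNReal.ofReal_pow (norm_nonneg _), ofReal_norm]
  rw [h, lintegral_enorm_pow_two_eq_eLpNorm_sq, ENNReal.toReal_pow]

/-- **Triangle inequality for vorticities in `L²`.** For `C^∞` fields `f, w` with `D⁰, D¹ ∈ L²`:
`|√Z(f) − √Z(w)| ≤ √(∫|curl(f − w)|²)`. [folklore] -/
theorem sqrt_enstrophy_sub_le (hf : ContDiff ℝ (⊤ : ℕ∞) f) (hf1 : ∫⁻ x, ‖iteratedFDeriv ℝ 1 f x‖ₑ ^ 2 < ⊤)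
    (hw : ContDiff ℝ (⊤ : ℕ∞) w) (hw1 : ∫⁻ x, ‖iteratedFDeriv ℝ 1 w x‖ₑ ^ 2 < ⊤) :
    |Real.sqrt (∫ x, ‖curl f x‖ ^ 2) - Real.sqrt (∫ x, ‖curl w x‖ ^ 2)| ≤
      Real.sqrt (∫ x, ‖curl (f - w) x‖ ^ 2) := by
  have mf : MemLp (curl f) 2 volume := memLp_two_curl hf hf1
  have mw : MemLp (curl w) 2 volume := memLp_two_curl hw hw1
  -- the difference
  have hcurl_sub : curl (f - w) = curl f - curl w := by
    funext x
    rw [show f - w = fun y => f y - w y from rfl]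
    exact curl_sub (hf.differentiable (by norm_cast) x) (hw.differentiable (by norm_cast) x)
  have mfw : MemLp (curl (f - w)) 2 volume := by rw [hcurl_sub]; exact mf.sub mw
  rw [integral_norm_sq_eq_of_memLp mf, integral_norm_sq_eq_of_memLp mw, integral_norm_sq_eq_of_memLp mfw,
    Real.sqrt_sq ENNReal.toReal_nonneg, Real.sqrt_sq ENNReal.toReal_nonneg, Real.sqrt_sq ENNReal.toReal_nonneg, hcurl_sub]
  -- `|‖a‖ − ‖b‖| ≤ ‖a − b‖` in `L²`
  have hne1 : eLpNorm (curl f) 2 volume ≠ ⊤ := mf.eLpNorm_ne_top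
  have hne2 : eLpNorm (curl w) 2 volume ≠ ⊤ := mw.eLpNorm_ne_top
  have hne3 : eLpNorm (curl f - curl w) 2 volume ≠ ⊤ := (mf.sub mw).eLpNorm_ne_top
  rw [abs_sub_le_iff]
  constructor
  · -- `‖curl f‖ ≤ ‖curl f − curl w‖ + ‖curl w‖`
    have h := eLpNorm_add_le (mf.1.sub mw.1) mw.1 (by norm_num : (1 : ℝ≥0∞) ≤ 2)
    rw [sub_add_cancel] at h
    have h' := ENNReal.toReal_mono (ENNReal.add_ne_top.2 ⟨hne3, hne2⟩) h
    rw [ENNReal.toReal_add hne3 hne2] at h'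
    linarith
  · have h := eLpNorm_add_le (mw.1.sub mf.1) mf.1 (by norm_num : (1 : ℝ≥0∞) ≤ 2)
    rw [sub_add_cancel, eLpNorm_sub_comm] at h
    have h' := ENNReal.toReal_mono (ENNReal.add_ne_top.2 ⟨hne3, hne1⟩) h
    rw [ENNReal.toReal_add hne3 hne1] at h'
    linarith

/-- **Enstrophy window from scale-free closeness.** If `∫|curl(f − w)|² ≤ ε²·∫|curl f|²` (`0 ≤ ε`) then
`(1 − ε)²·Z(f) ≤ Z(w) ≤ (1 + ε)²·Z(f)` (for `ε ≤ 1` on the left). [folklore] -/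
theorem enstrophy_window_of_close (hf : ContDiff ℝ (⊤ : ℕ∞) f) (hf1 : ∫⁻ x, ‖iteratedFDeriv ℝ 1 f x‖ₑ ^ 2 < ⊤)
    (hw : ContDiff ℝ (⊤ : ℕ∞) w) (hw1 : ∫⁻ x, ‖iteratedFDeriv ℝ 1 w x‖ₑ ^ 2 < ⊤) {ε : ℝ} (hε : 0 ≤ ε) (hε1 : ε ≤ 1)
    (hclose : ∫ x, ‖curl (f - w) x‖ ^ 2 ≤ ε ^ 2 * ∫ x, ‖curl f x‖ ^ 2) :
    (1 - ε) ^ 2 * (∫ x, ‖curl f x‖ ^ 2) ≤ ∫ x, ‖curl w x‖ ^ 2 ∧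
      (∫ x, ‖curl w x‖ ^ 2) ≤ (1 + ε) ^ 2 * ∫ x, ‖curl f x‖ ^ 2 := by
  set Zf : ℝ := ∫ x, ‖curl f x‖ ^ 2 with hZf
  set Zw : ℝ := ∫ x, ‖curl w x‖ ^ 2 with hZw
  have hZf0 : 0 ≤ Zf := integral_nonneg fun x => by positivity
  have hZw0 : 0 ≤ Zw := integral_nonneg fun x => by positivity
  have htri := sqrt_enstrophy_sub_le hf hf1 hw hw1
  have hd : Real.sqrt (∫ x, ‖curl (f - w) x‖ ^ 2) ≤ ε * Real.sqrt Zf := by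
    calc Real.sqrt (∫ x, ‖curl (f - w) x‖ ^ 2) ≤ Real.sqrt (ε ^ 2 * Zf) := Real.sqrt_le_sqrt hclose
      _ = ε * Real.sqrt Zf := by rw [Real.sqrt_mul (sq_nonneg _), Real.sqrt_sq hε]
  rw [abs_sub_le_iff] at htri
  have hsf := Real.sqrt_nonneg Zf
  have hsw := Real.sqrt_nonneg Zw
  have hup : Real.sqrt Zw ≤ (1 + ε) * Real.sqrt Zf := by linarith [htri.2]
  have hlow : (1 - ε) * Real.sqrt Zf ≤ Real.sqrt Zw := by linarith [htri.1]
  constructor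
  · have h := mul_self_le_mul_self (by nlinarith) hlow
    have e1 : (1 - ε) * Real.sqrt Zf * ((1 - ε) * Real.sqrt Zf) = (1 - ε) ^ 2 * Zf := by
      rw [← Real.sq_sqrt hZf0]; ring_nf; rw [Real.sq_sqrt hZf0, Real.sq_sqrt hZf0]
    have e2 : Real.sqrt Zw * Real.sqrt Zw = Zw := Real.mul_self_sqrt hZw0
    rw [e1, e2] at h
    exact h
  · have h := mul_self_le_mul_self hsw hup
    have e1 : (1 + ε) * Real.sqrt Zf * ((1 + ε) * Real.sqrt Zf) = (1 + ε) ^ 2 * Zf := by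
      have := Real.mul_self_sqrt hZf0
      nlinarith [this]
    have e2 : Real.sqrt Zw * Real.sqrt Zw = Zw := Real.mul_self_sqrt hZw0
    rw [e1, e2] at h
    exact h

/-- **The scale of a near-maximiser slice.** For an admissible `m`, a `C^∞` slice `f` with `D¹f ∈ L²`, orbit parameters
`(a, R, l)` with `l > 0`, and scale-free `Ḣ¹` closeness `∫|curl(f − g·m)|² ≤ ε²·∫|curl f|²` (`0 ≤ ε ≤ 1`):
`(1 − ε)²·Z(f) ≤ l·Z(m) ≤ (1 + ε)²·Z(f)`. [folklore] -/
theorem orbit_scale_window {m : EuclideanSpace ℝ (Fin 3) → EuclideanSpace ℝ (Fin 3)}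
    (hm : ContDiff ℝ (⊤ : ℕ∞) m ∧ VectorCalculus.IsDivFree m ∧ (∫⁻ x, ‖iteratedFDeriv ℝ 0 m x‖ₑ ^ 2 < ⊤) ∧
      (∫⁻ x, ‖iteratedFDeriv ℝ 1 m x‖ₑ ^ 2 < ⊤) ∧ (∫⁻ x, ‖iteratedFDeriv ℝ 2 m x‖ₑ ^ 2 < ⊤))
    (hf : ContDiff ℝ (⊤ : ℕ∞) f) (hf1 : ∫⁻ x, ‖iteratedFDeriv ℝ 1 f x‖ₑ ^ 2 < ⊤)
    (a : EuclideanSpace ℝ (Fin 3)) (R : EuclideanSpace ℝ (Fin 3) ≃ₗᵢ[ℝ] EuclideanSpace ℝ (Fin 3)) {l : ℝ} (hl : 0 < l)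
    {ε : ℝ} (hε : 0 ≤ ε) (hε1 : ε ≤ 1)
    (hclose : ∫ x, ‖curl (f - fun y => l • R (m (l • R.symm (y - a)))) x‖ ^ 2 ≤ ε ^ 2 * ∫ x, ‖curl f x‖ ^ 2) :
    (1 - ε) ^ 2 * (∫ x, ‖curl f x‖ ^ 2) ≤ l * ∫ x, ‖curl m x‖ ^ 2 ∧
      l * (∫ x, ‖curl m x‖ ^ 2) ≤ (1 + ε) ^ 2 * ∫ x, ‖curl f x‖ ^ 2 := by
  have hgm := admissible_orbitSlice hm a R hl
  rw [← integral_curl_sq_orbitSlice m a R hl]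
  exact enstrophy_window_of_close hf hf1 hgm.1 hgm.2.2.2.1 hε hε1 hclose

end Scale

end ReferenceShadowing

end RigidExit

end Summit.NavierStokesRegularity.NavierStokesRegularity.Theorems

end
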